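import Summits.BirchSwinnertonDyer.BirchSwinnertonDyer.Theorems.CyclotomicUntwistStabilisedUntwistFunctionalIdentity
import Summits.BirchSwinnertonDyer.BirchSwinnertonDyer.Theorems.CyclotomicUntwistC1OfStabilisedUntwistRootLaw
import Literature.NumberTheory.EllipticCurves.TwistNewformAtkinLi
import HarnessLib

/-!
# The `α`-stabilised untwist from ATKIN–LI: the functional identity (★) `G − α·G(p·) = ∑ᵤ η(u) f(· + u/p^c)`
# modulo ONE named print fact (route `CyclotomicUntwist`, crux K1 `PSRankOneLowerHalfAtThree`, child C1)

Cell `pub/bsd-wall` (D-0145 line `route-BirchSwinnertonDyer-CyclotomicUntwist`), width seat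
`bsd-line-cycu-p5` (gen 13). Sequel of `CyclotomicUntwistStabilisedUntwistFunctionalIdentity` (p645897).
THEOREMS ONLY (no definition, no `sorry`); the one print input is the Literature named fact
`Literature.NumberTheory.EllipticCurves.atkinLi_twist_newform_of_gamma0` (by name, hypothesis `hAL`).
BSD is not proved by this file; no crux or child of the route is; K1/K2 stay OPEN.

WHAT. The previous file reduced the modular hypothesis (★) of the lattice road to C1
(`PSStabilisedTwist.psi_sub_eq_sum_ratPlusSymbol`, hypothesis `hG`) to a RESIDUAL PACKET statement about the
newform `g₀` of the twist `f ⊗ η⁻¹`. Here that residue is discharged from the printed Atkin–Li theorem: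

* §1 the PRINT input `Literature.NumberTheory.EllipticCurves.atkinLi_twist_newform_of_gamma0` (Atkin–Li 1978
  Thm. 3.2, in the form of
  Best–Bober–Booker–Costa–Cremona–Derickx–Lee–Lowry-Duda–Roe–Sutherland–Voight 2021, §11.1 (11.1.1)–(11.1.3),
  (11.1.8), Lemma 11.2.1(a)): for a newform `f ∈ S_k(Γ₀(N))` and a primitive `ψ` mod `m` there is a newform
  `g = f ⊗ ψ` of level `M ∣ lcm(N, m²)` with `aₙ(g) = ψ(n)aₙ(f)` for EVERY `n` coprime to `m` and nebentypus
  `ψ²` (`ε_g(n) = ψ(n)²` for `n` coprime to `M m`).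
* §2 kernel: `dvd_level_of_nebentypus_eq_sq` — if `ε_g(n) = ψ(n)²` for all `n` coprime to `M m`, `m = p^c`,
  and `ψ²` is non-trivial, then `p ∣ M` (Chinese remainder: otherwise some `n ≡ 1 (mod M)` has `ψ(n)² ≠ 1`);
  `cuspCoeff_stabilisedUntwist_of_all` / `stabilisedUntwist_hG_of_all` — the coefficient identity and (★)
  from the ALL-`n` packet `aₙ(g₀) = η⁻¹(n)aₙ(f)` (`p ∤ n`) plus `p ∣ N₀` (no prime-power recursions needed).
* §3 `exists_stabilisedUntwist_of_atkinLi` — **(★) ⟸ PRINT**: from `atkinLi_twist_newform_of_gamma0`,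
  for a newform `f ∈ S_k(Γ₀(N))`, a prime `p`, `c ≥ 1` and a primitive `η` mod `p^c` with `η²` non-trivial,
  there are `N₀` and a newform `g₀ ∈ S_k(Γ₁(N₀))` with `p ∣ N₀`, `aₙ(g₀) = η⁻¹(n)aₙ(f)` for `p ∤ n`, and
  `(τ(η)•g₀)(τ) − a_p(g₀)·(τ(η)•g₀)(pτ) = 1·∑_{u mod p^c} η(u) f(u.val/p^c +ᵥ τ)` — LITERALLY the hypothesis `hG`
  of `PSStabilisedTwist` (`G := τ(η)•g₀`, `α := a_p(g₀)`, `κ := 1`). For the route (`p = 3`, `c = 2`,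
  `f = f_W`): the remaining print residue of F1′ behind (★) is ONLY the root relation `α² − a_w α + 3 = 0`
  (LAW (T) of `PSUntwistedTraceDefs`).

References: [cite: AtkinLi1978, Thm. 3.2 and Prop. 3.1] · [cite: BestEtAl2021, §11.1 (11.1.1)–(11.1.3), (11.1.8),
Lemma 11.2.1] · [cite: Shimura1971, Prop. 3.64] · [cite: MazurTateTeitelbaum1986Invent, §I.14 (case p ∣ N)].
-/

noncomputable section

open scoped MatrixGroups

open CongruenceSubgroup UpperHalfPlane Complex Function
open Literature.NumberTheory.EllipticCurves Literature.NumberTheory.EllipticCurves.ModularForms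

-- single-conjunct summit: `Summit.BirchSwinnertonDyer.BirchSwinnertonDyer.…` repeats the name by design
set_option linter.dupNamespace false
set_option autoImplicit false

namespace Summit.BirchSwinnertonDyer.BirchSwinnertonDyer.Theorems.PSStabilisedUntwistOfAtkinLi

/-! ### §1 The printed input

The named fact `Literature.NumberTheory.EllipticCurves.atkinLi_twist_newform_of_gamma0` (Atkin–Li 1978, Thm. 3.2 /
Prop. 3.1, special case of a source on `Γ₀(N)`; file `Literature/NumberTheory/EllipticCurves/TwistNewformAtkinLi.lean`)
is taken BY NAME as the hypothesis `hAL` of §3. -/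

/-! ### §2 Kernel: the prime of the conductor divides the level; (★) from the all-`n` packet -/

section Kernel

variable {N N₀ : ℕ} [NeZero N] [NeZero N₀] {k : ℤ} {m : ℕ} [NeZero m] {p : ℕ}
variable {f : CuspForm (Gamma0 N) k} {g₀ : CuspForm (Gamma1 N₀) k}

/-- **The conductor prime divides the level.** If a Dirichlet character `ε` mod `M` satisfies
`ε(n) = ψ(n)²` for every `n` coprime to `M·p^c` (`ψ` a character mod `p^c`) and `ψ²` is non-trivial, then
`p ∣ M`: otherwise `M` and `p^c` are coprime and the Chinese remainder theorem gives `n ≡ 1 (mod M)`,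
`n ≡ u (mod p^c)` for a unit `u` with `ψ(u)² ≠ 1`, whence `1 = ε(n) = ψ(u)² ≠ 1`. [folklore] -/
theorem dvd_level_of_nebentypus_eq_sq {M c : ℕ} [NeZero M] (hp : p.Prime) (ε : DirichletCharacter ℂ M)
    (ψ : DirichletCharacter ℂ (p ^ c)) (hε : ∀ n : ℕ, n.Coprime (M * p ^ c) → ε n = ψ n ^ 2)
    (hψ : ψ ^ 2 ≠ 1) : p ∣ M := by
  haveI : NeZero (p ^ c) := ⟨pow_ne_zero _ hp.ne_zero⟩
  obtain ⟨u, hu⟩ := MulChar.ne_one_iff.mp hψ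
  rw [MulChar.pow_apply_coe] at hu
  by_contra hpM
  have hco : M.Coprime (p ^ c) :=
    Nat.Coprime.pow_right c ((Nat.Prime.coprime_iff_not_dvd hp).mpr hpM).symm
  obtain ⟨n, hnM, hnp⟩ := Nat.chineseRemainder hco 1 (u : ZMod (p ^ c)).val
  have hnM' : (n : ZMod M) = 1 := by
    have := (ZMod.natCast_eq_natCast_iff n 1 M).mpr hnM
    rwa [Nat.cast_one] at this
  have hnp' : (n : ZMod (p ^ c)) = (u : ZMod (p ^ c)) := by
    have := (ZMod.natCast_eq_natCast_iff n (u : ZMod (p ^ c)).val (p ^ c)).mpr hnp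
    rwa [ZMod.natCast_zmod_val] at this
  have hcop : n.Coprime (M * p ^ c) := by
    refine Nat.Coprime.mul_right ?_ ?_
    · rw [← ZMod.isUnit_iff_coprime, hnM']
      exact isUnit_one
    · rw [← ZMod.isUnit_iff_coprime, hnp']
      exact Units.isUnit u
  have h := hε n hcop
  rw [hnM', map_one, hnp'] at h
  exact hu h.symm

/-- **Coefficients of the `α`-stabilised untwist from the all-`n` packet.** If `aₙ(g₀) = η⁻¹(n)·aₙ(f)` for every
`n` prime to `p`, `p ∣ N₀` (`U_p`: `a_{pn}(g₀) = a_p(g₀)aₙ(g₀)`) and `p ∣ m`, then with `α := a_p(g₀)`,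
`G := τ(η)•g₀`, `H := twistRaw L _ _ f η⁻¹`: `aₙ(G) − α·[p ∣ n]·a_{n/p}(G) = aₙ(H)` for every `n`.
[cite: Shimura1971, Prop. 3.64] [cite: DiamondShurman2005, Prop. 5.8.5] -/
theorem cuspCoeff_stabilisedUntwist_of_all (L : ℕ) [NeZero L] (hNL : N ∣ L) (hmL : m ^ 2 ∣ L)
    {η : DirichletCharacter ℂ m} (hη : η.IsPrimitive) (hg₀ : IsNewform1 g₀) (hp : p.Prime) (hpm : p ∣ m)
    (hpN₀ : p ∣ N₀) (hall : ∀ n : ℕ, ¬ p ∣ n → cuspCoeff g₀ n = η⁻¹ (n : ZMod m) * cuspCoeff f n) (n : ℕ) :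
    cuspCoeff (gaussSum η (ZMod.stdAddChar (N := m)) • g₀) n -
        cuspCoeff g₀ p * (if p ∣ n then cuspCoeff (gaussSum η (ZMod.stdAddChar (N := m)) • g₀) (n / p)
          else 0) =
      cuspCoeff (twistRaw L hNL hmL f η⁻¹) n := by
  rw [cuspCoeff_twistRaw L hNL hmL f (isPrimitive_inv hη) n, inv_inv, cuspCoeff_smul_gamma1]
  by_cases hpn : p ∣ n
  · obtain ⟨n', rfl⟩ := hpn
    rw [if_pos (dvd_mul_right p n'), Nat.mul_div_cancel_left n' hp.pos, cuspCoeff_smul_gamma1,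
      PSStabilisedUntwist.cuspCoeff_prime_mul_of_dvd_level hg₀ hp hpN₀ n',
      PSStabilisedUntwist.apply_natCast_eq_zero_of_dvd η⁻¹ hp hpm (dvd_mul_right p n')]
    ring
  · rw [if_neg hpn, hall n hpn]
    ring

/-- **(★) from the all-`n` packet, in the shape of `PSStabilisedTwist`** (`m = p^c`, `c ≥ 1`):
`(τ(η)•g₀)(τ) − a_p(g₀)·(τ(η)•g₀)(pτ) = 1 · ∑_{u mod p^c} η(u) f(u.val/p^c +ᵥ τ)` for every `τ ∈ ℍ`.
[cite: Shimura1971, Prop. 3.64] [cite: AtkinLi1978, §3] -/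
theorem stabilisedUntwist_hG_of_all {c : ℕ} [NeZero (p ^ c)] {η : DirichletCharacter ℂ (p ^ c)}
    (hη : η.IsPrimitive) (hg₀ : IsNewform1 g₀) (hp : p.Prime) (hc : c ≠ 0) (hpN₀ : p ∣ N₀)
    (hall : ∀ n : ℕ, ¬ p ∣ n → cuspCoeff g₀ n = η⁻¹ (n : ZMod (p ^ c)) * cuspCoeff f n) (τ : ℍ) :
    (gaussSum η (ZMod.stdAddChar (N := p ^ c)) • g₀) τ -
        cuspCoeff g₀ p * (gaussSum η (ZMod.stdAddChar (N := p ^ c)) • g₀) (ofComplex ((p : ℂ) * (τ : ℂ))) =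
      1 * ∑ u : ZMod (p ^ c), η u * f ((((u.val : ℚ) / (p : ℚ) ^ c : ℚ) : ℝ) +ᵥ τ) := by
  haveI : NeZero (N * (p ^ c) ^ 2) := ⟨mul_ne_zero (NeZero.ne N) (pow_ne_zero 2 (NeZero.ne (p ^ c)))⟩
  rw [PSStabilisedUntwist.apply_sub_mul_apply_mul_eq_of_cuspCoeff (HeckeTGamma1.one_mem_strictPeriods_Gamma1 N₀)
    (HeckeTGamma1.one_mem_strictPeriods_Gamma1 (N * (p ^ c) ^ 2)) _ _ hp.pos _
    (cuspCoeff_stabilisedUntwist_of_all (N * (p ^ c) ^ 2) (dvd_mul_right N _) (dvd_mul_left _ N) hη hg₀ hp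
      (dvd_pow_self p hc) hpN₀ hall) τ, PSStabilisedUntwist.twistRaw_apply, one_mul]
  refine Finset.sum_congr rfl fun u _ ↦ ?_
  rw [inv_inv, twistShift, Nat.cast_pow]

end Kernel

/-! ### §3 (★) from print: the `α`-stabilised untwist exists by Atkin–Li -/

section OfPrint

variable {N : ℕ} [NeZero N] {k : ℤ} {p c : ℕ} [NeZero (p ^ c)]
variable {f : CuspForm (Gamma0 N) k} {η : DirichletCharacter ℂ (p ^ c)}

/-- **(★) ⟸ PRINT (Atkin–Li).** Granted `atkinLi_twist_newform_of_gamma0` (Atkin–Li 1978, Thm. 3.2): for a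
newform `f ∈ S_k(Γ₀(N))`, a prime `p`, `c ≥ 1` and a PRIMITIVE `η` mod `p^c` with `η²` non-trivial, there are
a level `N₀ ∣ lcm(N, p^{2c})` and a newform `g₀ ∈ S_k(Γ₁(N₀))` — the newform of `f ⊗ η⁻¹` — with `p ∣ N₀`
(`dvd_level_of_nebentypus_eq_sq`), `aₙ(g₀) = η⁻¹(n)aₙ(f)` for every `n` prime to `p`, and, for `G := τ(η)•g₀`,
`α := a_p(g₀)`: `G(τ) − α·G(pτ) = 1·∑_{u mod p^c} η(u) f(u.val/p^c +ᵥ τ)` on `ℍ` — the hypothesis `hG` (with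
`κ = 1`) of `PSStabilisedTwist.psi_sub_eq_sum_ratPlusSymbol`. For the route (`p = 3`, `c = 2`, `f = f_W`,
`η` of order `3` or `6`): the untwist `g₀` and its functional identity come from print; the root relation
`a₃(g₀)² − a_w·a₃(g₀) + 3 = 0` is NOT supplied here. [cite: AtkinLi1978, Thm. 3.2]
[cite: BestEtAl2021, §11.1 (11.1.2), (11.1.8)] [cite: Shimura1971, Prop. 3.64] -/
theorem exists_stabilisedUntwist_of_atkinLi
    (hAL : Literature.NumberTheory.EllipticCurves.atkinLi_twist_newform_of_gamma0) (hf : IsNewform0 f)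
    (hη : η.IsPrimitive) (hη2 : η ^ 2 ≠ 1) (hp : p.Prime) (hc : c ≠ 0) :
    ∃ (N₀ : ℕ) (_ : NeZero N₀) (g₀ : CuspForm (Gamma1 N₀) k), IsNewform1 g₀ ∧ N₀ ∣ Nat.lcm N ((p ^ c) ^ 2) ∧
      p ∣ N₀ ∧ (∀ n : ℕ, ¬ p ∣ n → cuspCoeff g₀ n = η⁻¹ (n : ZMod (p ^ c)) * cuspCoeff f n) ∧
      ∀ τ : ℍ, (gaussSum η (ZMod.stdAddChar (N := p ^ c)) • g₀) τ -
          cuspCoeff g₀ p * (gaussSum η (ZMod.stdAddChar (N := p ^ c)) • g₀) (ofComplex ((p : ℂ) * (τ : ℂ))) =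
        1 * ∑ u : ZMod (p ^ c), η u * f ((((u.val : ℚ) / (p : ℚ) ^ c : ℚ) : ℝ) +ᵥ τ) := by
  obtain ⟨N₀, _, g₀, hg₀, hN₀, hcoef, hchar⟩ := hAL hf (isPrimitive_inv hη)
  have hη2' : (η⁻¹) ^ 2 ≠ 1 := by
    rw [inv_pow]
    exact fun h ↦ hη2 (inv_eq_one.mp h)
  have hpN₀ : p ∣ N₀ := dvd_level_of_nebentypus_eq_sq hp (nebentypus g₀) η⁻¹ hchar hη2'
  have hall : ∀ n : ℕ, ¬ p ∣ n → cuspCoeff g₀ n = η⁻¹ (n : ZMod (p ^ c)) * cuspCoeff f n :=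
    fun n hpn ↦ hcoef n (((Nat.Prime.coprime_iff_not_dvd hp).mpr hpn).symm.pow_right c)
  exact ⟨N₀, inferInstance, g₀, hg₀, hN₀, hpN₀, hall,
    fun τ ↦ stabilisedUntwist_hG_of_all hη hg₀ hp hc hpN₀ hall τ⟩

end OfPrint

/-! ### §4 C1 from PRINT + Atkin–Li + the ROOT LAW -/

section C1

open Literature.NumberTheory.EllipticCurves.Rank1Residual Summit.BirchSwinnertonDyer.BirchSwinnertonDyer.Theses.CyclotomicUntwist

/-- **C1 `PSUntwistedLFunctionAtThree` ⟸ PRINT + ATKIN–LI + ROOT LAW.** The hypothesis `hE` (stabilised untwist in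
eigenform currency) of `PSC1OfStabilisedUntwist.psUntwistedLFunctionAtThree_of_print_of_stabilisedUntwist_of_rootLaw`
(p647270) is DISCHARGED by `exists_stabilisedUntwist_of_atkinLi` from the named fact
`Literature.NumberTheory.EllipticCurves.atkinLi_twist_newform_of_gamma0`. What remains besides PRINT (modularity,
Carayol's level, GZ86 I.(7.3), GZK, Atkin–Li Thm. 3.2 — all BY NAME) is the single research hypothesis `hN2`, the ROOT
LAW «on every PS row some primitive `η` mod `9` with `η² ≠ 1` makes `a₃(g₀)` a root of `X² − a_w(W)X + 3` for every
newform `g₀` (`3 ∣` level) with `aₙ(g₀) = η⁻¹(n)aₙ(f_W)` off `3`» (LAW (T); Deligne + Carayol (A) + the inertia analysis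
on PS rows — NOT proved here). The conclusion is the crux child C1 VERBATIM. BSD is not proved by this; C1 stays
conditional on `hN2`. [cite: AtkinLi1978, Thm. 3.2] [cite: MazurTateTeitelbaum1986Invent, §I.14 (case p ∣ N)]
[cite: Carayol1986, Thm. (A)] [cite: GrossZagier1986, Thm. I.(7.3)] -/
theorem psUntwistedLFunctionAtThree_of_print_of_atkinLi_of_rootLaw
    (hmod : nonempty_modularParametrizationData)
    (hlev : ∀ (N : ℕ) [NeZero N], IsNewformOf.level_eq_conductorNorm (N := N))
    (hGZ86 : GrossZagier1986_thm_I_7_3) (hGZK : PublishedInputGZK)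
    (hAL : Literature.NumberTheory.EllipticCurves.atkinLi_twist_newform_of_gamma0)
    (hN2 : ∀ (W : WeierstrassCurve ℚ) [W.IsElliptic] [W.IsGloballyMinimal], ¬ W.HasCM →
      Summit.BirchSwinnertonDyer.Rank1Residual.Additive.ClassO6 W 3 → Surj W 3 →
      Even (padicValInt 3 W.minimalDiscriminantInt) →
      W.minimalDiscriminantInt / 3 ^ padicValInt 3 W.minimalDiscriminantInt % 3 = 1 →
      W.analyticRank = 1 →
      ∀ {N : ℕ} [NeZero N] (f : CuspForm (Gamma0 N) 2), IsNewformOf W f →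
      ∃ η : DirichletCharacter ℂ (3 ^ 2), η.IsPrimitive ∧ η ^ 2 ≠ 1 ∧
        ∀ {N₀ : ℕ} [NeZero N₀] (g₀ : CuspForm (Gamma1 N₀) 2), IsNewform1 g₀ → 3 ∣ N₀ →
          (∀ n : ℕ, ¬ 3 ∣ n → cuspCoeff g₀ n = η⁻¹ (n : ZMod (3 ^ 2)) * cuspCoeff f n) →
          cuspCoeff g₀ 3 ^ 2 - ((W.psUntwistedTrace : ℤ) : ℂ) * cuspCoeff g₀ 3 + 3 = 0) :
    PSUntwistedLFunctionAtThree :=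
  haveI : NeZero (3 ^ 2) := ⟨by norm_num⟩
  PSC1OfStabilisedUntwist.psUntwistedLFunctionAtThree_of_print_of_stabilisedUntwist_of_rootLaw hmod hlev hGZ86 hGZK
    (fun hf _ hη hη2 ↦ exists_stabilisedUntwist_of_atkinLi hAL hf hη hη2 Nat.prime_three two_ne_zero) hN2

end C1

end Summit.BirchSwinnertonDyer.BirchSwinnertonDyer.Theorems.PSStabilisedUntwistOfAtkinLi

end
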